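import Summits.AnomalousDissipation.AnomalousDissipation.Theses.QuarticLadder
import Summits.AnomalousDissipation.AnomalousDissipation.Theorems.MomentLadder.Negative.LoadBearing
import Summits.AnomalousDissipation.AnomalousDissipation.Theorems.MomentParityMomentClosure

/-!
# Disproof of `MomentClosure` (stmt-AnomalousDissipation-15063, route QuarticLadder) — findings:
# NO KILL POSSIBLE — the crux is a THEOREM of the tree; load-bearing / vacuity anatomy below

Refuter crux-attack (refuter-rattack-stmt-AnomalousDissipation-15063-0, 2026-08-17), one cycle of the
basic attacks. Everything here is kernel-checked (rc 0, no `sorry`, axioms propext / Classical.choice /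
Quot.sound).

* TRUTH (`momentClosure_holds`, `example … = … := rfl`): `QuarticLadder.MomentClosure` is the
  DEFINITIONAL twin of `MomentParity.MomentClosure` (same text in two route files) and the latter is
  PROVED in tree (`Theorems.momentClosure_proof`, stmt-11467, std axioms). Hence `¬ MomentClosure` is
  unprovable (short of inconsistency): no refutation, substantive or misstated, exists. The item closes
  by the prover one-liner `theorem … : Theses.QuarticLadder.MomentClosure := Theorems.momentClosure_proof`
  (candidate attached on the item twice: planner `QuarticLadderSharedProofs.lean`, refuter batch 78).
  Consequence for the line `birth`: both stubs are instances of landed lemmas, but the composition is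
  moot — the whole crux is one `exact`.
* READING (`momentClosure_iff`, `Iff.rfl`): through the landed clause vocabulary
  (`Theorems/MomentLadder/Negative/Clauses.lean`) the crux is
  `∀ f ν N E ε R κ, 0 < ν → (∀ d, ∃ μ_d, IsLadderWitness f ν N E ε R κ d μ_d) → ∃ μ, IsInvariantWitness …`;
  `R` and `κ` are quantified BEFORE `d` (common support ball and tail schedule), as the informal text
  says; no ℕ-subtraction, no division, `toReal` of the enstrophy is finite on the level ball.
* (a) LOAD-BEARING (`momentClosure_false_without_ladder`): with the ladder hypothesis dropped the
  statement is FALSE (`R = -1`: no probability law is supported in the empty ball) — the hypotheses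
  are not decoration.
* (e) MUTATION (`momentClosureStrong_holds`, `momentClosure_of_strong`): the three hypotheses
  `IsDivFree f`, `HasZeroMean f`, `0 < ν` are UNNECESSARY — the crux for every smooth `f` and every
  real `ν` holds by the twin proof script verbatim (band-limited tests kill the zero mode and are
  solenoidal, so the mean and gradient parts of `f` are invisible; compactness needs no sign of `ν`).
* (b) NON-VACUITY (`ladder_inhabited_loud`, `invariant_inhabited_loud`): the hypothesis block is
  inhabited at a LOUD point (`0 < ν`, `0 < ε`, every order `d`: the laminar Kolmogorov Dirac of the
  landed `momentLadderWithoutVanishingViscosity_holds`), and so is the conclusion block — neither side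
  is a junk existential.
* (d) DEGENERATE CORNERS where the implication is vacuous (`ladder_vacuous_level_zero`,
  `ladder_vacuous_neg_radius`): level `N = 0` with `ε > 0`, and `R < 0` — outside the route's regime
  (`∃ᶠ N`, `R` a support radius); no side condition is missing.
* RESTATES-THE-SUMMIT probes (folder `F.lean`, expected failures, rc 1 with exactly 3 errors):
  `MomentClosure` by `exact? | aesop | intro…;aesop` — whnf timeout / fail; `MomentClosure →
  AnomalousDissipation` by `exact? | aesop | unfold;aesop` — unsolved; `AnomalousDissipation →
  MomentClosure` by `exact? | aesop` — unsolved (true only because the crux is a theorem, `W.lean`).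
* Cheapest falsifier by compute: not applicable (proved; infinite-dimensional measure statement).

-- Targets: none broken (stubs `stub_polyStationaryLimit`, `stub_cylindricalUpgrade` of `Lines/birth.lean`
are steps 1–3 / step 4 of the landed twin proof; `CylindricalTest` fields are smooth, div-free AND
mean-zero and band-limitation kills the zero mode, so the dropped `IsDivFree f`/`HasZeroMean f` in
stub 2 open no gap). Near-misses: none.
-/

set_option linter.dupNamespace false

noncomputable section

namespace Summit.AnomalousDissipation.AnomalousDissipation.Cruxes.MomentClosure.Disproof

open MeasureTheory Filter Topology UnitAddTorus
open scoped InnerProductSpace RealInnerProductSpace ENNReal NNReal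
open Literature.Analysis.FunctionSpaces Literature.Analysis.FluidPDE
open Summit.AnomalousDissipation.AnomalousDissipation.Theses.QuarticLadder (MomentClosure)
open Summit.AnomalousDissipation.AnomalousDissipation.Theorems.CubicParityLoud.Negative (H3)
open Summit.AnomalousDissipation.AnomalousDissipation.Theorems.QuarticGate.Negative
open Summit.AnomalousDissipation.AnomalousDissipation.Theorems.MomentLadder.Negative
open Summit.AnomalousDissipation.AnomalousDissipation.Theorems.MomentParityMomentClosure

/-- The conclusion block of `MomentClosure` after `∃ μ` (verbatim clauses, named). -/
def IsInvariantWitness (f : UnitAddTorus (Fin 3) → EuclideanSpace ℝ (Fin 3)) (ν : ℝ) (N : ℕ)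
    (E ε R : ℝ) (κ : ℕ → ℕ) (μ : Measure (Torus.energySpace (Fin 3))) : Prop :=
  IsProbabilityMeasure μ ∧ (∀ᵐ u ∂μ, IsLevel N u) ∧ IsSupported R μ ∧ IsResolved κ μ ∧
    (∀ Φ : Torus.CylindricalTest (Fin 3),
      (∀ i, (∀ k ∉ (Torus.freqBall N).erase (0 : Fin 3 → ℤ),
        UnitAddTorus.mFourierCoeff (EuclideanSpace.complexify ∘ (Φ.g i)) k = 0)) →
      Integrable (fun u => Torus.nsGeneratorPairing ν f u (Φ.grad u)) μ ∧
        ∫ u, Torus.nsGeneratorPairing ν f u (Φ.grad u) ∂μ = 0) ∧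
    Torus.ensembleEnergy μ ≤ E ∧ ε ≤ Torus.ensembleDissipation ν μ

/-- READING (A1, quantifier order): the crux is definitionally
`∀ f ν N E ε R κ, 0 < ν → (∀ d, ∃ μ_d ladder-witness) → ∃ μ invariant-witness`. -/
theorem momentClosure_iff :
    MomentClosure ↔ ∀ f : UnitAddTorus (Fin 3) → EuclideanSpace ℝ (Fin 3),
      Torus.IsSmooth f → Torus.IsDivFree f → Torus.HasZeroMean f →
      ∀ (ν : ℝ) (N : ℕ) (E ε R : ℝ) (κ : ℕ → ℕ), 0 < ν →
      (∀ d : ℕ, ∃ μ, IsLadderWitness f ν N E ε R κ d μ) →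
        ∃ μ, IsInvariantWitness f ν N E ε R κ μ :=
  Iff.rfl

/-- TRUTH: the crux is the definitional twin of the PROVED `MomentParity.MomentClosure`. -/
theorem momentClosure_holds : MomentClosure :=
  Summit.AnomalousDissipation.AnomalousDissipation.Theorems.momentClosure_proof

example : MomentClosure =
    Summit.AnomalousDissipation.AnomalousDissipation.Theses.MomentParity.MomentClosure := rfl

/-- The crux with its ladder hypothesis DROPPED. -/
def MomentClosureWithoutLadder : Prop :=
  ∀ f : UnitAddTorus (Fin 3) → EuclideanSpace ℝ (Fin 3),
    Torus.IsSmooth f → Torus.IsDivFree f → Torus.HasZeroMean f →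
    ∀ (ν : ℝ) (N : ℕ) (E ε R : ℝ) (κ : ℕ → ℕ), 0 < ν → ∃ μ, IsInvariantWitness f ν N E ε R κ μ

/-- LOAD-BEARING (A: hypotheses are not decoration): without the ladder hypothesis the statement is
false — at `R = -1` no probability measure is supported in the empty ball. [folklore] -/
theorem momentClosure_false_without_ladder : ¬ MomentClosureWithoutLadder := fun h => by
  obtain ⟨μ, hP, -, hR, -⟩ := h (kolField 1) (isSmooth_kolField 1) (isDivFree_kolField 1)
    (hasZeroMean_kolField 1) 1 0 0 0 (-1) id one_pos
  obtain ⟨u, hu⟩ := (hR : ∀ᵐ u ∂μ, ‖u‖ ≤ (-1 : ℝ)).exists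
  linarith [norm_nonneg u]

/-- NON-VACUITY (B): the ladder hypothesis block is inhabited at a LOUD point (`0 < ν`, `0 < ε`,
every order `d`) — the laminar Kolmogorov Dirac of the landed load-bearing analysis. [folklore] -/
theorem ladder_inhabited_loud :
    ∃ (f : UnitAddTorus (Fin 3) → EuclideanSpace ℝ (Fin 3)) (ν : ℝ) (N : ℕ) (E ε R : ℝ) (κ : ℕ → ℕ),
      Torus.IsSmooth f ∧ Torus.IsDivFree f ∧ Torus.HasZeroMean f ∧ 0 < ν ∧ 0 < ε ∧
      ∀ d : ℕ, ∃ μ, IsLadderWitness f ν N E ε R κ d μ := by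
  obtain ⟨f, hfs, hfd, hfz, ν, E, ε, hν, hε, hj⟩ := momentLadderWithoutVanishingViscosity_holds
  obtain ⟨R, κ, hfreq⟩ := hj 0
  obtain ⟨N, hN⟩ := hfreq.exists
  exact ⟨f, ν 0, N, E, ε, R, κ, hfs, hfd, hfz, hν 0, hε, hN⟩

/-- … and therefore (by the proved crux) the conclusion block is inhabited at a loud point: the
`∃ μ` of the conclusion is not a junk existential. [folklore] -/
theorem invariant_inhabited_loud :
    ∃ (f : UnitAddTorus (Fin 3) → EuclideanSpace ℝ (Fin 3)) (ν : ℝ) (N : ℕ) (E ε R : ℝ) (κ : ℕ → ℕ),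
      0 < ν ∧ 0 < ε ∧ ∃ μ, IsInvariantWitness f ν N E ε R κ μ := by
  obtain ⟨f, ν, N, E, ε, R, κ, hfs, hfd, hfz, hν, hε, hd⟩ := ladder_inhabited_loud
  exact ⟨f, ν, N, E, ε, R, κ, hν, hε, momentClosure_iff.1 momentClosure_holds f hfs hfd hfz ν N E ε R κ hν hd⟩

/-- DEGENERATE CORNER (d): at level `N = 0` with `ε > 0` the ladder hypothesis is unsatisfiable
(level-0 laws are `δ₀`, dissipation `0`), so the crux is vacuously true there — not the route's regime
(`∃ᶠ N`). [folklore] -/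
theorem ladder_vacuous_level_zero {f : UnitAddTorus (Fin 3) → EuclideanSpace ℝ (Fin 3)} {ν E ε R : ℝ}
    (hν : 0 < ν) (hε : 0 < ε) {κ : ℕ → ℕ} :
    ¬ (∀ d : ℕ, ∃ μ, IsLadderWitness f ν 0 E ε R κ d μ) := fun h => by
  obtain ⟨μ, hμ⟩ := h 0
  exact not_isLadderWitness_level_zero hν.le hε hμ

/-- DEGENERATE CORNER (d'): at `R < 0` the ladder hypothesis is unsatisfiable too. [folklore] -/
theorem ladder_vacuous_neg_radius {f : UnitAddTorus (Fin 3) → EuclideanSpace ℝ (Fin 3)} {ν E ε R : ℝ}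
    (hR : R < 0) {N : ℕ} {κ : ℕ → ℕ} :
    ¬ (∀ d : ℕ, ∃ μ, IsLadderWitness f ν N E ε R κ d μ) := fun h => by
  obtain ⟨μ, hP, -, hS, -⟩ := h 0
  obtain ⟨u, hu⟩ := (hS : ∀ᵐ u ∂μ, ‖u‖ ≤ R).exists
  linarith [norm_nonneg u]


/-! ### (e) Hypothesis mutation: the STRENGTHENED crux holds (dropped `IsDivFree f`, `HasZeroMean f`, `0 < ν`) -/

/-- NATURAL STRENGTHENING that HOLDS: the crux for EVERY smooth force `f` (no solenoidality, no zero
mean) and EVERY real `ν` (no sign). -/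
def MomentClosureStrong : Prop :=
  ∀ f : UnitAddTorus (Fin 3) → EuclideanSpace ℝ (Fin 3), Torus.IsSmooth f →
    ∀ (ν : ℝ) (N : ℕ) (E ε R : ℝ) (κ : ℕ → ℕ),
    (∀ d : ℕ, ∃ μ, IsLadderWitness f ν N E ε R κ d μ) →
    ∃ μ : Measure (Torus.energySpace (Fin 3)), IsProbabilityMeasure μ ∧ (∀ᵐ u ∂μ, IsLevel N u) ∧
      IsSupported R μ ∧ IsResolved κ μ ∧
      (∀ Φ : Torus.CylindricalTest (Fin 3),
        (∀ i, (∀ k ∉ (Torus.freqBall N).erase (0 : Fin 3 → ℤ),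
          UnitAddTorus.mFourierCoeff (EuclideanSpace.complexify ∘ (Φ.g i)) k = 0)) →
        Integrable (fun u => Torus.nsGeneratorPairing ν f u (Φ.grad u)) μ ∧
          ∫ u, Torus.nsGeneratorPairing ν f u (Φ.grad u) ∂μ = 0) ∧
      Torus.ensembleEnergy μ ≤ E ∧ ε ≤ Torus.ensembleDissipation ν μ

/-- The strengthened crux holds: the twin proof script `Theorems.momentClosure_proof` verbatim, with
the three unused binders gone. [folklore] -/
theorem momentClosureStrong_holds : MomentClosureStrong := by
  intro f hfs ν N E ε R κ hd
  have hd' : ∀ d : ℕ, ∃ μ : Measure H3, IsProbabilityMeasure μ ∧ (∀ᵐ u ∂μ, IsLevel N u) ∧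
      IsSupported R μ ∧ IsResolved κ μ ∧ IsPolyStationary ν f N d μ ∧
      Torus.ensembleEnergy μ ≤ E ∧ ε ≤ Torus.ensembleDissipation ν μ := hd
  choose μ hμP hμL hμR hμT hμS hμE hμD using hd'
  have hf : Integrable f volume := hfs.integrable
  have hR : 0 ≤ R := by
    haveI := hμP 0
    obtain ⟨u, hu⟩ := (hμR 0).exists
    exact (norm_nonneg u).trans hu
  set K : Set H3 := {u : H3 | IsLevel N u ∧ ‖u‖ ≤ R} with hK_def
  have hK : IsCompact K := isCompact_levelBall N hR
  have hμK : ∀ d, ∀ᵐ u ∂μ d, u ∈ K := fun d => (hμL d).and (hμR d)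
  obtain ⟨μ', hμ'P, hμ'K, hlim⟩ := exists_limit_measure_of_isCompact hK μ hμP hμK
  haveI := hμ'P
  haveI : ∀ d, IsProbabilityMeasure (μ d) := hμP
  refine ⟨μ', hμ'P, hμ'K.mono fun u hu => hu.1, hμ'K.mono fun u hu => hu.2, fun n => ?_,
    fun Φ hΦ => ?_, ?_, ?_⟩
  · rw [tail_iff hR hμ'K (κ n) n]
    refine hlim _ ((continuous_bandEnstrophy _).sub (continuous_bandEnstrophy _)) (Set.Iic _)
      isClosed_Iic (Eventually.of_forall fun d => ?_)
    exact (tail_iff hR (hμK d) (κ n) n).1 (hμT d n)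
  · refine ⟨integrable_of_continuous_of_ae_mem hK hμ'K (Torus.continuous_nsGeneratorPairing_grad ν hf Φ),
      integral_nsGeneratorPairing_grad_eq_zero ν hf hR hμ'K Φ fun P => ?_⟩
    have hband : ∀ i, IsBandTest N (Φ.g i) := fun i =>
      ⟨Φ.g_smooth i, Φ.g_divFree i, Φ.g_zeroMean i, hΦ i⟩
    refine hlim _ (continuous_nsGeneratorPairing_polyGrad ν hf Φ.g_smooth P) {0} isClosed_singleton ?_
    filter_upwards [eventually_ge_atTop (P.totalDegree + 1)] with d hd
    exact (hμS d Φ.m Φ.g P hband hd).2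
  · exact hlim (fun u : H3 => ‖u‖ ^ 2) (continuous_norm.pow 2) (Set.Iic E) isClosed_Iic
      (Eventually.of_forall fun d => hμE d)
  · have hcl : IsClosed {t : ℝ | ε ≤ ν * t} := isClosed_le continuous_const (continuous_const.mul continuous_id)
    have key := hlim _ (continuous_bandEnstrophy (Torus.freqBall N)) _ hcl
      (Eventually.of_forall fun d => by
        have h := hμD d
        rw [Torus.ensembleDissipation, Torus.ensembleEnstrophy, lintegral_eGradNormSq_eq hR (hμK d),
          ENNReal.toReal_ofReal (integral_nonneg (bandEnstrophy_nonneg _))] at h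
        exact h)
    rw [Torus.ensembleDissipation, Torus.ensembleEnstrophy, lintegral_eGradNormSq_eq hR hμ'K,
      ENNReal.toReal_ofReal (integral_nonneg (bandEnstrophy_nonneg _))]
    exact key

/-- … and it gives the crux back (the dropped hypotheses are simply ignored). -/
theorem momentClosure_of_strong (h : MomentClosureStrong) : MomentClosure :=
  fun f hfs _ _ ν N E ε R κ _ hd => h f hfs ν N E ε R κ hd

end Summit.AnomalousDissipation.AnomalousDissipation.Cruxes.MomentClosure.Disproof

end
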